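import Summits.ResolutionOfSingularities.ResolutionOfSingularities.Theorems.PurelyInseparableDim4SpineWin
import Summits.ResolutionOfSingularities.ResolutionOfSingularities.Theorems.PurelyInseparableDim4SpineD1
import Summits.ResolutionOfSingularities.ResolutionOfSingularities.Theorems.PurelyInseparableDim4SpineDictionary
import Summits.ResolutionOfSingularities.ResolutionOfSingularities.Theorems.PurelyInseparableDim4SpivakovskyWeakWin
import HarnessLib
import HarnessLib.Audit.Tags

/-!
# [OURS · res-dim4-pi PR-9c, capstone] F4-S of the frame HOLDS: some permissible coordinate rule wins the
  SPINE game, for every exponent `q > 0` and every characteristic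

Cell `res-dim4-pi` (D-0157 DOOR 2, wave 2), brick **PR-9c** (desk WORD #25 (e): consortium `res-dim4-p-11`
(lead, Spivakovsky 1983 in Lean) · `res-dim4-p-5` · `res-dim4-p-10` · `res-dim4-p-14`; this file by
`res-dim4-p-10`, «width 10»).  The ASSEMBLY, def-free, of landed bricks only:

* `PolyhedraGame.weakWin_holds` — SPIVAKOVSKY'S THEOREM for Hironaka's polyhedra game, weak (printed)
  threshold, every index type and every set of active coordinates (`res-dim4-p-11` / `res-dim4-p-5`,
  `PurelyInseparableDim4Spivakovsky*`) [cite: Spivakovsky1983, Theorem p. 421];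
* `purePositionalWin4_of_weakWin` — weak ⇒ STRICT by the boundary lemma, and positional determinacy
  (`res-dim4-p-10`, `PurelyInseparableDim4PolyhedraBoundary` / `…SpineWin`; `res-dim4-p-14`,
  `PurelyInseparableDim4GameDeterminacy` / `…SpinePositional`);
* `positionalWin4_of_purePositionalWin4` — LEMMA D1, the cleaning deletions cost nothing (`res-dim4-p-10`,
  `PurelyInseparableDim4SpineD1`);
* `SpineDictionary.spineTerminatesSomeRule_of_positionalWin4` — the support dictionary spine ↔ game
  (`res-dim4-p-7`, `PurelyInseparableDim4SpineDictionary`).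

## What is proved
* `purePositionalWin4_of_pos : 0 < q → PurePositionalWin4 q` and `purePositionalWin4_iff_pos` (with
  `not_purePositionalWin4_zero`): TY-9's named hypothesis is now a THEOREM exactly for `q > 0`;
* `positionalWin4_of_pos : 0 < q → PositionalWin4 q`;
* `spineTerminatesSomeRule_of_pos : 0 < q → SpineTerminatesSomeRule p q` (every `p`);
* **`spineTerminatesSomeRuleQuestion_holds : SpineTerminatesSomeRuleQuestion`** — the POSITIVE edge on the
  Scope file's `@[conjecture]` F4-S: for every prime `p`, over every field of characteristic `p`, SOME
  permissible coordinate-centre rule of the frame admits no infinite branch of SPINE edges (chart origins).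

Honest scope: the SPINE regime only (`b = 0`); the full coordinate game `TerminatesSomeRule 2 2` is REFUTED
in the tree (`PurelyInseparableDim4CoordinateTrap`), and the typed MODE-1h question `Terminates1h 2 2` too
(`PurelyInseparableDim4Mode1hTwoCycle`).  [OURS · counted 0 · AI kernel work, weaker than expert review]
A theorem about OUR frame's combinatorial shadow; NOTHING here proves resolution of singularities in
dimension ≥ 4 / characteristic `p`.
bears_on: LADDER-RESOLUTION:D157-DOOR2 (res-dim4-pi · PR-9c). Supports stmt-ResolutionOfSingularities-16155
(helper).
-/

set_option linter.dupNamespace false -- mandated namespace of this single-conjunct summit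

namespace Summit.ResolutionOfSingularities.ResolutionOfSingularities.Theorems.PIDim4

/-- **Hironaka's PURE constrained polyhedra game in four variables — STRICT threshold («the chart origin is
no longer `q`-fold») — has a positional winning strategy for player A, for every `q > 0`.**
(Spivakovsky 1983 + the boundary lemma + positional determinacy.) [cite: Spivakovsky1983, Theorem p. 421] -/
theorem purePositionalWin4_of_pos {q : ℕ} (hq : 0 < q) : PurePositionalWin4 q :=
  purePositionalWin4_of_weakWin (fun I => PolyhedraGame.weakWin_holds (Fin 4) I) hq

/-- TY-9's named hypothesis `PurePositionalWin4 q` holds exactly for `q > 0`. [folklore] -/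
theorem purePositionalWin4_iff_pos {q : ℕ} : PurePositionalWin4 q ↔ 0 < q := by
  refine ⟨fun h => Nat.pos_of_ne_zero ?_, purePositionalWin4_of_pos⟩
  rintro rfl
  exact not_purePositionalWin4_zero h

/-- **The SPINE game (pure move + cleaning deletions) has a positional winning strategy, `q > 0`.**
(LEMMA D1 on top of the pure game.) [folklore] -/
theorem positionalWin4_of_pos {q : ℕ} (hq : 0 < q) : PositionalWin4 q :=
  positionalWin4_of_purePositionalWin4 q (purePositionalWin4_of_pos hq)

/-- **F4-S at every exponent `q > 0` and every `p`**: over every field of characteristic `p`, some permissible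
coordinate-centre rule has no infinite branch of spine edges. (The support dictionary of `res-dim4-p-7`.)
[folklore] -/
theorem spineTerminatesSomeRule_of_pos (p : ℕ) {q : ℕ} (hq : 0 < q) : SpineTerminatesSomeRule p q :=
  SpineDictionary.spineTerminatesSomeRule_of_positionalWin4 p q (positionalWin4_of_pos hq)

/-- **F4-S OF THE FRAME HOLDS** (positive edge on the `@[conjecture]` `SpineTerminatesSomeRuleQuestion` of
`PurelyInseparableDim4Scope`): for every prime `p`, with `q = p`, some permissible coordinate-centre rule
wins the spine game of the purely inseparable fourfold frame `z^p + F(x₁, …, x₄)`.  A statement about OUR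
frame at chart origins; not a statement about resolution of singularities. [folklore] -/
theorem spineTerminatesSomeRuleQuestion_holds : SpineTerminatesSomeRuleQuestion :=
  fun p hp => spineTerminatesSomeRule_of_pos p hp.pos

/-! ## Every dimension -/

/-- **Hironaka's constrained polyhedra game with the STRICT threshold is won by player A from every lattice
position, in EVERY dimension and every set of active coordinates** (not only four variables): Spivakovsky's
theorem `PolyhedraGame.weakWin_holds` (`res-dim4-p-11` / `res-dim4-p-5`) composed with the strict-endgame
BOUNDARY LEMMA `PolyhedraGame.forces_strict_of_boundary` through `PolyhedraGame.forces_strict_of_weakWin`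
(`res-dim4-p-10`).  Unconditional; threshold `t > 0`. [cite: Spivakovsky1983, Theorem p. 421] -/
theorem PolyhedraGame.forces_strict {σ : Type} [DecidableEq σ] (I : Finset σ) {t : ℕ} (ht : 0 < t)
    (P : PolyhedraGame.Pos σ) :
    PolyhedraGame.Forces (PolyhedraGame.StrictWon t I) t I P :=
  PolyhedraGame.forces_strict_of_weakWin I (fun I' _ => PolyhedraGame.weakWin_holds σ I') ht P

end Summit.ResolutionOfSingularities.ResolutionOfSingularities.Theorems.PIDim4
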